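import Summits.BirchSwinnertonDyer.BirchSwinnertonDyer.Theorems.Rank1ResidualJetKolyvaginClassOrder
import Summits.BirchSwinnertonDyer.BirchSwinnertonDyer.Theorems.ClassRecordThreeEulerHalvesAtThreeSection6Bridge
import HarnessLib

/-!
# The walk's S7 input `hordκ` DISCHARGED: `p^{k−j} ∣ ord c_k(m) ⟹ ord_p(P_m) ≤ j` for the concrete
# Kolyvagin classes of a data system (cell `bsd-stepL`, seat `bsd-stepL-tam3-p1`, helper toward item
# 19109 `EulerHalvesAtThree`, registered stub `stub_jetchevMaxHLAtThree`)

HONEST FRAMING. Nothing here proves BSD, J₃ or any divisibility of a Heegner point; the registered stub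
is NOT discharged; no item closes; 0 classes move (T7); `--supports stmt-BirchSwinnertonDyer-19109`
(helper). WHAT THIS FILE DOES. One of the named hypotheses of the instantiated walk
`Koly.tamagawaExponent_le_m_of_rowFamilies` (`…EulerHalvesAtThreeWalkFamilies`, p496626) — `hordκ`:
for every admissible conductor `m` and `j < k`, `p^{k−j} ∣ ord c_k(m)` forces `ord_p(P_m) ≤ j`
([J] §3.1 items 4–5: `ord κ_{c,k} = p^{k − m'(c)}`) — is PROVED for a total data system
`D : ∀ m, KolyvaginHeegnerData Dt β ι m`, from bsd-jet pv-2's `JET.zsmul_kolyvaginClass_eq_zero_iff`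
(McCallum Cor. 4.5: `j • c_M(n) = 0 ↔ p^M ∣ j • P_n`, `Rank1ResidualJetKolyvaginClassOrder`, 04:16Z)
with its two standing inputs SUPPLIED as there: admissibility from `ρ̄_{E,p}` onto
(`RingClassNoTorsion.isAdmissible_pointsSubgroup`, Gross Lemma 4.3) and the invariance of `[P_m]` mod
`p^k` from Gross Prop. 3.6 ∕ McCallum (4) for data at every divisor
(`KolyCert.toGeomPoints_derivedPoint_mem_invPoints_of_dvd_zhang`; here the divisor data are `D`
itself). `hordκ_of_rowData` is the hypothesis of p496626 VERBATIM (its binders `c ∣ m`, square-free,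
Kolyvagin factors of index `≥ k`), under the extra frame inputs `(N_E, d_K) = 1` and `d_K < −4` that the
invariance lemma carries; `hordκ_of_admissibleData` is the same for data on the admissible-conductor
subtype (the `hordκ` of `…WalkFamiliesAdm`). So the named lists of both walk files lose `hordκ`.
References (locators only; no cited FACT declared): [cite: Jetchev2008, §3.1 items 4–5 (p. 817)]
[cite: McCallumLMS1991, §4 (4)–(5), Cor. 4.5; §5 (p. 305)] [cite: GrossLMS1991, Prop. 3.6, Lemma 4.3].
Design: theorems only; `K : Type`. Axioms: `propext`, `Classical.choice`, `Quot.sound`.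
-/

set_option autoImplicit false

noncomputable section

open scoped Classical NumberField

namespace Summit.BirchSwinnertonDyer.Rank1Residual.X11b.Three.Koly

open WeierstrassCurve IsDedekindDomain NumberField Field Literature.NumberTheory.EllipticCurves
  Literature.NumberTheory.EllipticCurves.ModularForms Literature.NumberTheory.GaloisRepresentations
  Summit.BirchSwinnertonDyer.Rank1Residual.X11b Summit.BirchSwinnertonDyer.Rank1Residual.JET

variable {K : Type} [Field K] [NumberField K] (W : WeierstrassCurve ℚ) [W.IsElliptic] [W.IsGloballyMinimal]
  [NeZero (W.conductorNorm ℤ)]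

/-- **`p^{k−j} ∣ ord c_k(m)` with `j < k` forces `ord_p(P_m) ≤ j`** for the class of a datum of an
admissible conductor `m` (square-free, Kolyvagin prime factors of index `≥ k`) drawn from a total data
system `D` (so data exist at every divisor of `m`): if `p^{j+1} ∣ P_m` then `p^{k−j−1} • c_k(m)` is the
class of `p^{k−j−1} P_m ∈ p^k E(K[m])`, hence `0` (`JET.zsmul_kolyvaginClass_eq_zero_iff`), so
`ord c_k(m) ∣ p^{k−j−1}` — contradiction. Frame: `K` imaginary quadratic, `(N_E, d_K) = 1`, `d_K < −4`,
`p` odd with `ρ̄_{E,p}` onto. [cite: Jetchev2008, §3.1 items 4–5 (p. 817)]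
[cite: McCallumLMS1991, Cor. 4.5, §5 (p. 305)] -/
theorem divOrd_le_of_pow_dvd_addOrderOf_kolyvaginClass (hK : IsImaginaryQuadratic K)
    (hND : IsCoprime ((W.conductorNorm ℤ : ℕ) : ℤ) (NumberField.discr K)) (hD : NumberField.discr K < -4)
    {p : ℕ} [Fact p.Prime] (hp2 : p ≠ 2) (hρ : W.HasSurjectiveModNGaloisRep p)
    (Dt : ModularParametrizationData W (W.conductorNorm ℤ)) (β : ℤ) (ι : K →+* ℂ)
    (D : ∀ m : ℕ, KolyvaginHeegnerData Dt β ι m) {k : ℕ} {m : ℕ} (hm : Squarefree m)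
    (hkol : ∀ q ∈ m.primeFactors,
      Zhang2014.IsKolyvaginPrime (W.conductorNorm ℤ) W K p q ∧ k ≤ Zhang2014.kolyvaginIndex W p q)
    {j : ℕ} (hj : j < k)
    (hdvd : p ^ (k - j) ∣ addOrderOf ((D m).kolyvaginClass (Fact.out : p.Prime) k :
      galoisCohomology ((W.baseChange K).torsionGaloisModule ((p ^ k : ℕ) : ℤ)) 1)) :
    divOrd (D m) p ≤ (j : ℕ∞) := by
  have hp : p.Prime := Fact.out
  by_contra hlt
  rw [not_le] at hlt
  -- `p^{j+1} ∣ P_m`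
  have hle : ((j + 1 : ℕ) : ℕ∞) ≤ divOrd (D m) p := Order.add_one_le_of_lt (by exact_mod_cast hlt)
  obtain ⟨Q, hQ⟩ := pDiv_of_le_divOrd (D m) p (j + 1) hle
  -- the two standing inputs
  have hA := RingClassNoTorsion.isAdmissible_pointsSubgroup (D m) hK hm.ne_zero hp hp2 hρ k
  have hP := KolyCert.toGeomPoints_derivedPoint_mem_invPoints_of_dvd_zhang hK ι Dt hp hND hD hm hkol
    (fun m' _ ↦ D m') m dvd_rfl
  -- `p^{k-j-1} • c_k(m) = 0`
  have hzero : ((p ^ (k - j - 1) : ℕ) : ℤ) • (D m).kolyvaginClass hp k = 0 := by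
    rw [zsmul_kolyvaginClass_eq_zero_iff (D m) hp k hA hP]
    refine ⟨Q, ?_⟩
    have hkj : k - j - 1 + (j + 1) = k := by omega
    rw [← hQ, smul_smul, ← Nat.cast_mul, ← pow_add, hkj]
  -- hence `ord c_k(m) ∣ p^{k-j-1}`, contradicting `p^{k-j} ∣ ord c_k(m)`
  have hord : addOrderOf ((D m).kolyvaginClass hp k) ∣ p ^ (k - j - 1) := by
    apply addOrderOf_dvd_of_nsmul_eq_zero
    rw [← natCast_zsmul]
    exact_mod_cast hzero
  have h1 : p ^ (k - j) ∣ p ^ (k - j - 1) := dvd_trans hdvd hord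
  have h2 : k - j ≤ k - j - 1 := (Nat.pow_dvd_pow_iff_le_right hp.one_lt).mp h1
  omega

/-- **The hypothesis `hordκ` of `Koly.tamagawaExponent_le_m_of_rowFamilies` (p496626), VERBATIM, for a
total data system** — under the frame inputs of the invariance lemma (`(N_E, d_K) = 1`, `d_K < −4`) and
`ρ̄_{E,p}` onto. [cite: Jetchev2008, §3.1 items 4–5 (p. 817)] [cite: McCallumLMS1991, Cor. 4.5] -/
theorem hordκ_of_rowData (hK : IsImaginaryQuadratic K)
    (hND : IsCoprime ((W.conductorNorm ℤ : ℕ) : ℤ) (NumberField.discr K)) (hD : NumberField.discr K < -4)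
    {p : ℕ} [Fact p.Prime] (hp2 : p ≠ 2) (hρ : W.HasSurjectiveModNGaloisRep p)
    (Dt : ModularParametrizationData W (W.conductorNorm ℤ)) (β : ℤ) (ι : K →+* ℂ)
    (D : ∀ m : ℕ, KolyvaginHeegnerData Dt β ι m) (k c : ℕ) :
    ∀ (m : ℕ), c ∣ m → Squarefree m →
      (∀ q ∈ m.primeFactors, Zhang2014.IsKolyvaginPrime (W.conductorNorm ℤ) W K p q ∧
        k ≤ Zhang2014.kolyvaginIndex W p q) →
      ∀ j : ℕ, j < k →
        p ^ (k - j) ∣ addOrderOf ((D m).kolyvaginClass (Fact.out : p.Prime) k :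
          galoisCohomology ((W.baseChange K).torsionGaloisModule ((p ^ k : ℕ) : ℤ)) 1) →
        divOrd (D m) p ≤ (j : ℕ∞) :=
  fun _ _ hm hkol _ hj hdvd ↦
    divOrd_le_of_pow_dvd_addOrderOf_kolyvaginClass W hK hND hD hp2 hρ Dt β ι D hm hkol hj hdvd

/-- **The same for data on the ADMISSIBLE-conductor subtype** (the `hordκ` hypothesis of
`Koly.tamagawaExponent_le_m_of_admissibleFamilies`, `…WalkFamiliesAdm`, VERBATIM): the subtype of
square-free conductors all of whose prime factors are Kolyvagin primes of index `≥ k` is closed under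
divisors, so the data at the divisors of `s` required by the invariance lemma are read off `D` itself.
[cite: Jetchev2008, §3.1 items 4–5 (p. 817)] [cite: McCallumLMS1991, Cor. 4.5, §5 (p. 305)] -/
theorem hordκ_of_admissibleData (hK : IsImaginaryQuadratic K)
    (hND : IsCoprime ((W.conductorNorm ℤ : ℕ) : ℤ) (NumberField.discr K)) (hD : NumberField.discr K < -4)
    {p : ℕ} [Fact p.Prime] (hp2 : p ≠ 2) (hρ : W.HasSurjectiveModNGaloisRep p)
    (Dt : ModularParametrizationData W (W.conductorNorm ℤ)) (β : ℤ) (ι : K →+* ℂ) (k : ℕ)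
    (D : ∀ s : {m : ℕ // Squarefree m ∧ ∀ q ∈ m.primeFactors,
        Zhang2014.IsKolyvaginPrime (W.conductorNorm ℤ) W K p q ∧ k ≤ Zhang2014.kolyvaginIndex W p q},
      KolyvaginHeegnerData Dt β ι s.1) :
    ∀ s (j : ℕ), j < k →
      p ^ (k - j) ∣ addOrderOf ((D s).kolyvaginClass (Fact.out : p.Prime) k :
        galoisCohomology ((W.baseChange K).torsionGaloisModule ((p ^ k : ℕ) : ℤ)) 1) →
      divOrd (D s) p ≤ (j : ℕ∞) := by
  intro s j hj hdvd
  have hp : p.Prime := Fact.out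
  -- data at every divisor of `s`, from `D` (divisors of admissible conductors are admissible)
  have hdiv : ∀ m : ℕ, m ∣ s.1 → Squarefree m ∧ ∀ q ∈ m.primeFactors,
      Zhang2014.IsKolyvaginPrime (W.conductorNorm ℤ) W K p q ∧ k ≤ Zhang2014.kolyvaginIndex W p q :=
    fun m hm ↦ ⟨s.2.1.squarefree_of_dvd hm, fun q hq ↦
      s.2.2 q (Nat.primeFactors_mono hm s.2.1.ne_zero hq)⟩
  by_contra hlt
  rw [not_le] at hlt
  have hle : ((j + 1 : ℕ) : ℕ∞) ≤ divOrd (D s) p := Order.add_one_le_of_lt (by exact_mod_cast hlt)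
  obtain ⟨Q, hQ⟩ := pDiv_of_le_divOrd (D s) p (j + 1) hle
  have hA := RingClassNoTorsion.isAdmissible_pointsSubgroup (D s) hK s.2.1.ne_zero hp hp2 hρ k
  have hP := KolyCert.toGeomPoints_derivedPoint_mem_invPoints_of_dvd_zhang hK ι Dt hp hND hD s.2.1 s.2.2
    (fun m hm ↦ D ⟨m, hdiv m hm⟩) s.1 dvd_rfl
  have hzero : ((p ^ (k - j - 1) : ℕ) : ℤ) • (D s).kolyvaginClass hp k = 0 := by
    rw [zsmul_kolyvaginClass_eq_zero_iff (D s) hp k hA hP]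
    refine ⟨Q, ?_⟩
    have hkj : k - j - 1 + (j + 1) = k := by omega
    rw [← hQ, smul_smul, ← Nat.cast_mul, ← pow_add, hkj]
  have hord : addOrderOf ((D s).kolyvaginClass hp k) ∣ p ^ (k - j - 1) := by
    apply addOrderOf_dvd_of_nsmul_eq_zero
    rw [← natCast_zsmul]
    exact_mod_cast hzero
  have h1 : p ^ (k - j) ∣ p ^ (k - j - 1) := dvd_trans hdvd hord
  have h2 : k - j ≤ k - j - 1 := (Nat.pow_dvd_pow_iff_le_right hp.one_lt).mp h1
  omega

end Summit.BirchSwinnertonDyer.Rank1Residual.X11b.Three.Koly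

end
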